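import Summits.BirchSwinnertonDyer.BirchSwinnertonDyer.Theorems.ResidualThetaTransportAtTwoSignedMuSeedAtTwoPlusFlatDetectsOfMuPackage
import Literature.NumberTheory.EllipticCurves.Kato2004.IwasawaCohomologyUniqueProofs
import HarnessLib

/-!
# Seed crux `SignedMuSeedAtTwoPlus` (stmt-BirchSwinnertonDyer-21438), line `kolyvagin_char_two`: the μ-package is INDEPENDENT of the pin
# `I = 𝐇¹_Γ(T₂W)` — transport along Kato's uniqueness `IwasawaH1Data.exists_linearEquiv` — so the `∃ I` package of S1 already yields
# S3 `FlatDetectsKatoClassModTwo` for EVERY `I` (route-independent; S3's text BY SHAPE from the `∃ I`-package)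

Cell `bsd-wall`, width seat `bsd-wall-rtt-p4-w2` g8. Sequel of `…FlatDetectsOfMuPackage` (p647275), which derived S3's text from the `∀ I` form of the
μ-package. HERE the `∀ I` form is shown to FOLLOW from the `∃ I` form (the shape consumed by `flatPlusLocalHalfAtTwo_of_muPackage`, p645548, and
`signedMuSeedAtTwoPlus_of_fine_of_muPackage`, p646071): any two pins `I`, `J` of `𝐇¹_Γ(T₂W)` are isomorphic compatibly with the layer
projections (`Kato2004.IwasawaH1Data.exists_linearEquiv`), genuine Euler-system classes and the functional `col` transport along the
isomorphism, and `¬ C 2 ∣ col s` is unchanged. Hence ONE displayed package text (the `∃ I` one) serves S1, S3 and the seed. THEOREMS ONLY — no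
definition, no named fact, no instance, no `sorry`; nothing about any curve is asserted; closes no item; BSD is NOT proved by any of this.

## What is proved

* `isEulerSystemClassTwo_map_of_proj_eq` — a projection-compatible map `e : I.H → J.H` carries genuine `2`-adic Euler-system classes to genuine ones
  (the predicate `IsEulerSystemClassTwo` only reads the layer projections).
* `muPackage_forall_of_exists` — `∃ I`-package ⇒ `∀ I`-package (same `Y, P, j, k`; `col ∘ e⁻¹`, `s ↦ e s`).
* `flatDetectsKatoClassModTwo_of_muPackage_exists` — **S3's text VERBATIM from the `∃ I` habitat μ-package**.

References: [Kato2004Asterisque] §12.2 (12.2.1) (p. 220), Thm. 12.4, §13.8 (p. 228); [Kobayashi2003] Thm. 6.3; [MazurRubin2004] Thm. 5.3.10.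
-/

set_option autoImplicit false
-- the Theorems namespace of this sub repeats the summit name by design (D-0017 nested layout)
set_option linter.dupNamespace false

noncomputable section

open scoped Classical NumberField MatrixGroups ModularForm

open WeierstrassCurve Field IsDedekindDomain CongruenceSubgroup
  Literature.NumberTheory.GaloisRepresentations
  Literature.NumberTheory.EllipticCurves Literature.NumberTheory.EllipticCurves.Module
  Literature.NumberTheory.EllipticCurves.ModularForms
  Literature.NumberTheory.EllipticCurves.IwasawaAlgebra Literature.NumberTheory.EllipticCurves.Kobayashi2003
  Literature.NumberTheory.EllipticCurves.Rank1Residual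
  Literature.NumberTheory.EllipticCurves.Kato2004 ZpExtension
  Summit.BirchSwinnertonDyer.Rank1Residual.Supersingular Summit.BirchSwinnertonDyer.Rank1Residual.X1

namespace Summit.BirchSwinnertonDyer.BirchSwinnertonDyer.Theorems

namespace SignedMuAtTwo.PlusLocalMuRoad

/-! ## §1 Transport of genuine classes along projection-compatible maps -/

section Transport

variable {W : WeierstrassCurve ℚ} [W.IsElliptic] [ContinuousSMul ℤ_[2] (W.tateModule 2)]
  [Module.Free ℤ_[2] (W.tateModule 2)] [Module.Finite ℤ_[2] (W.tateModule 2)]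
  {κ : ZpExtension ℚ 2} (hκ : κ.IsCyclotomic) {γ : Field.absoluteGaloisGroup ℚ}

/-- **Genuine `2`-adic Euler-system classes transport along projection-compatible maps of pins**: if `e : I.H → J.H` satisfies
`J.proj n (e x) = I.proj n x`, then `IsEulerSystemClassTwo W hκ I s → IsEulerSystemClassTwo W hκ J (e s)` (same Euler system `z`, same bad set).
[cite: Kato2004Asterisque, §12.2 (12.2.1) (p. 220) and §13.8 (p. 228)] -/
theorem isEulerSystemClassTwo_map_of_proj_eq (I J : Kato2004.IwasawaH1Data W 2 κ γ) (e : I.H → J.H)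
    (he : ∀ (n : ℕ) (x : I.H), J.proj n (e x) = I.proj n x) {s : I.H} (hs : Kato2004.IsEulerSystemClassTwo W hκ I s) :
    Kato2004.IsEulerSystemClassTwo W hκ J (e s) := by
  obtain ⟨S, hS, z, hz, hint, hproj⟩ := hs
  exact ⟨S, hS, z, hz, hint, fun n ↦ by rw [he, hproj]⟩

end Transport

/-! ## §2 `∃ I`-package ⇒ `∀ I`-package, and S3 from the `∃ I`-package -/

section AtTwo

/-- **The `∃ I` habitat μ-package implies the `∀ I` one.** Given the package at some pin `I₀` (with `col₀`, `s₀`) and another pin `I`, take the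
projection-compatible isomorphism `e : I₀.H ≃ I.H` (`IwasawaH1Data.exists_linearEquiv`), `col := col₀ ∘ e⁻¹`, `s := e s₀`: then `col s = col₀ s₀`,
`j ∘ col = 0`, `s` is genuine (`isEulerSystemClassTwo_map_of_proj_eq`), and the μ-clause is unchanged. [cite: Kato2004Asterisque, §12.2 (p. 220) and Thm. 12.4 (p. 221)] -/
theorem muPackage_forall_of_exists
    (hPkg : ∀ (W : WeierstrassCurve ℚ) [W.IsElliptic] [W.IsGloballyMinimal], ¬ W.HasCM → W.analyticRank = 0 →
      GoodSS W 2 → W.frobeniusTrace 2 = 0 → W.Δ < 0 →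
      ∀ [NeZero (W.conductorNorm ℤ)] (f : CuspForm (Gamma0 (W.conductorNorm ℤ)) 2), IsNewformOf W f →
      ∀ (ϖ : ℚ), (ϖ : ℝ) * W.realPeriodRat = plusPeriod f →
      ∀ (Lplus Lminus : IwasawaAlgebra 2), IsPollackPair f 2 Lplus Lminus →
      padicValRat 2 ϖ + MuLambda.mu Lminus = 0 →
      ∀ [ContinuousSMul ℤ_[2] (W.tateModule 2)] [Module.Free ℤ_[2] (W.tateModule 2)]
        [Module.Finite ℤ_[2] (W.tateModule 2)]
        (κ : ZpExtension ℚ 2) (γ : Field.absoluteGaloisGroup ℚ) (hκ : κ.IsCyclotomic), κ.IsTopGenerator γ →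
      ∀ (D : SignedSelmerDualData W κ γ 1),
      ∃ (I : Kato2004.IwasawaH1Data W 2 κ γ) (Y : W.FineSelmerDualData κ γ)
        (P : Submodule (IwasawaAlgebra 2) (IwasawaAlgebra 2))
        (col : I.H →ₗ[IwasawaAlgebra 2] P) (j : P →ₗ[IwasawaAlgebra 2] D.X)
        (k : D.X →ₗ[IwasawaAlgebra 2] Y.X) (s : I.H),
        (∀ x : I.H, j (col x) = 0) ∧
        (∀ (x : D.X) (t : W.fineSelmerInfty κ),
          Y.toDual (k x) t = D.toDual x (AddSubgroup.inclusion (fineSelmerInfty_le_signedSelmerInfty W κ 1) t)) ∧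
        LinearMap.ker k ≤ LinearMap.range j ∧
        Kato2004.IsEulerSystemClassTwo W hκ I s ∧ ¬ PowerSeries.C (2 : ℤ_[2]) ∣ (P.subtype (col s))) :
    ∀ (W : WeierstrassCurve ℚ) [W.IsElliptic] [W.IsGloballyMinimal], ¬ W.HasCM → W.analyticRank = 0 →
      GoodSS W 2 → W.frobeniusTrace 2 = 0 → W.Δ < 0 →
      ∀ [NeZero (W.conductorNorm ℤ)] (f : CuspForm (Gamma0 (W.conductorNorm ℤ)) 2), IsNewformOf W f →
      ∀ (ϖ : ℚ), (ϖ : ℝ) * W.realPeriodRat = plusPeriod f →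
      ∀ (Lplus Lminus : IwasawaAlgebra 2), IsPollackPair f 2 Lplus Lminus →
      padicValRat 2 ϖ + MuLambda.mu Lminus = 0 →
      ∀ [ContinuousSMul ℤ_[2] (W.tateModule 2)] [Module.Free ℤ_[2] (W.tateModule 2)]
        [Module.Finite ℤ_[2] (W.tateModule 2)]
        (κ : ZpExtension ℚ 2) (γ : Field.absoluteGaloisGroup ℚ) (hκ : κ.IsCyclotomic), κ.IsTopGenerator γ →
      ∀ (I : Kato2004.IwasawaH1Data W 2 κ γ) (D : SignedSelmerDualData W κ γ 1),
      ∃ (Y : W.FineSelmerDualData κ γ) (P : Submodule (IwasawaAlgebra 2) (IwasawaAlgebra 2))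
        (col : I.H →ₗ[IwasawaAlgebra 2] P) (j : P →ₗ[IwasawaAlgebra 2] D.X)
        (k : D.X →ₗ[IwasawaAlgebra 2] Y.X) (s : I.H),
        (∀ x : I.H, j (col x) = 0) ∧
        (∀ (x : D.X) (t : W.fineSelmerInfty κ),
          Y.toDual (k x) t = D.toDual x (AddSubgroup.inclusion (fineSelmerInfty_le_signedSelmerInfty W κ 1) t)) ∧
        LinearMap.ker k ≤ LinearMap.range j ∧
        Kato2004.IsEulerSystemClassTwo W hκ I s ∧ ¬ PowerSeries.C (2 : ℤ_[2]) ∣ (P.subtype (col s)) := by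
  intro W _ _ hCM hr hss ha hΔ _ f hf ϖ hϖ Lplus Lminus hP hflat _ _ _ κ γ hκ hγ I D
  obtain ⟨I₀, Y, P, col₀, j, k, s₀, hcompl, hk, hcover, hES, hμ⟩ :=
    hPkg W hCM hr hss ha hΔ f hf ϖ hϖ Lplus Lminus hP hflat κ γ hκ hγ D
  obtain ⟨e, he⟩ := Kato2004.IwasawaH1Data.exists_linearEquiv I₀ I hγ
  refine ⟨Y, P, col₀ ∘ₗ (e.symm : I.H →ₗ[IwasawaAlgebra 2] I₀.H), j, k, e s₀, fun x ↦ hcompl _, hk, hcover,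
    isEulerSystemClassTwo_map_of_proj_eq hκ I₀ I e he hES, ?_⟩
  rw [LinearMap.comp_apply, LinearEquiv.coe_coe, LinearEquiv.symm_apply_apply]
  exact hμ

/-- **S3 `stub_flatDetectsKatoClassModTwo` (text VERBATIM) from the `∃ I` habitat μ-package** — the SAME displayed hypothesis as
`flatPlusLocalHalfAtTwo_of_muPackage` (S1) and `signedMuSeedAtTwoPlus_of_fine_of_muPackage` (the seed): `muPackage_forall_of_exists` then
`flatDetectsKatoClassModTwo_of_muPackage`. [cite: Kato2004Asterisque, Thm. 12.5 (p. 222) and §12.2 (p. 220)] [cite: Kobayashi2003, Thm. 6.3 (p. 11)]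
[cite: MazurRubin2004, Thm. 5.3.10] -/
theorem flatDetectsKatoClassModTwo_of_muPackage_exists
    (hPkg : ∀ (W : WeierstrassCurve ℚ) [W.IsElliptic] [W.IsGloballyMinimal], ¬ W.HasCM → W.analyticRank = 0 →
      GoodSS W 2 → W.frobeniusTrace 2 = 0 → W.Δ < 0 →
      ∀ [NeZero (W.conductorNorm ℤ)] (f : CuspForm (Gamma0 (W.conductorNorm ℤ)) 2), IsNewformOf W f →
      ∀ (ϖ : ℚ), (ϖ : ℝ) * W.realPeriodRat = plusPeriod f →
      ∀ (Lplus Lminus : IwasawaAlgebra 2), IsPollackPair f 2 Lplus Lminus →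
      padicValRat 2 ϖ + MuLambda.mu Lminus = 0 →
      ∀ [ContinuousSMul ℤ_[2] (W.tateModule 2)] [Module.Free ℤ_[2] (W.tateModule 2)]
        [Module.Finite ℤ_[2] (W.tateModule 2)]
        (κ : ZpExtension ℚ 2) (γ : Field.absoluteGaloisGroup ℚ) (hκ : κ.IsCyclotomic), κ.IsTopGenerator γ →
      ∀ (D : SignedSelmerDualData W κ γ 1),
      ∃ (I : Kato2004.IwasawaH1Data W 2 κ γ) (Y : W.FineSelmerDualData κ γ)
        (P : Submodule (IwasawaAlgebra 2) (IwasawaAlgebra 2))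
        (col : I.H →ₗ[IwasawaAlgebra 2] P) (j : P →ₗ[IwasawaAlgebra 2] D.X)
        (k : D.X →ₗ[IwasawaAlgebra 2] Y.X) (s : I.H),
        (∀ x : I.H, j (col x) = 0) ∧
        (∀ (x : D.X) (t : W.fineSelmerInfty κ),
          Y.toDual (k x) t = D.toDual x (AddSubgroup.inclusion (fineSelmerInfty_le_signedSelmerInfty W κ 1) t)) ∧
        LinearMap.ker k ≤ LinearMap.range j ∧
        Kato2004.IsEulerSystemClassTwo W hκ I s ∧ ¬ PowerSeries.C (2 : ℤ_[2]) ∣ (P.subtype (col s))) :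
    ∀ (W : WeierstrassCurve ℚ) [W.IsElliptic] [W.IsGloballyMinimal], ¬ W.HasCM → W.analyticRank = 0 →
      GoodSS W 2 → W.frobeniusTrace 2 = 0 → W.Δ < 0 →
      ∀ [NeZero (W.conductorNorm ℤ)] (f : CuspForm (Gamma0 (W.conductorNorm ℤ)) 2), IsNewformOf W f →
      ∀ (ϖ : ℚ), (ϖ : ℝ) * W.realPeriodRat = plusPeriod f →
      ∀ (Lplus Lminus : IwasawaAlgebra 2), IsPollackPair f 2 Lplus Lminus →
      padicValRat 2 ϖ + MuLambda.mu Lminus = 0 →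
      ∀ [ContinuousSMul ℤ_[2] (W.tateModule 2)] [Module.Free ℤ_[2] (W.tateModule 2)]
        [Module.Finite ℤ_[2] (W.tateModule 2)]
        (κ : ZpExtension ℚ 2) (γ : Field.absoluteGaloisGroup ℚ) (hκ : κ.IsCyclotomic), κ.IsTopGenerator γ →
      ∀ (I : Kato2004.IwasawaH1Data W 2 κ γ),
        ∃ s : I.H, Kato2004.IsEulerSystemClassTwo W hκ I s ∧ ¬ ∃ y : I.H, s = (2 : IwasawaAlgebra 2) • y :=
  flatDetectsKatoClassModTwo_of_muPackage (muPackage_forall_of_exists hPkg)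

end AtTwo

end SignedMuAtTwo.PlusLocalMuRoad

end Summit.BirchSwinnertonDyer.BirchSwinnertonDyer.Theorems

end
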